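import Literature.MathematicalPhysics.QuantumFieldTheory.Balaban1983to89.B13Bound226Located
import Literature.MathematicalPhysics.QuantumFieldTheory.Balaban1983to89.B13Lemma3TorusTerms
import Literature.MathematicalPhysics.QuantumFieldTheory.Balaban1983to89.B9Thm37GlueTorus

/-!
# `Balaban1983to89.B13Lemma3TorusPrimitive` — T. Bałaban, *Renormalization group approach to lattice gauge field
theories. II. Cluster expansions*, Commun. Math. Phys. **116** (1988) 1–22 [Balaban1988RG2Cluster], pp. 15–17: on the
two-scale TORUS model (the papers' periodic carrier, [I] p. 251), the hypothesis «(2.26) FOR EVERY TERM» of Lemma 3 /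
of the §2 chain (`B13Lemma3TorusTerms.hrep_of_termwise`, `bound238_torus_of_226`, `deliverables_torus_termwise_of_226`)
supplied, term by term, by the PRIMITIVE-OBJECT capstone on the torus geometry
(`B13Bound226Located.norm_term214_le_226_of_primitives` at the instance of §1) — the torus twin of
`B13Lemma3WindowPrimitive.h226_of_primitives`, closing the torus-model chain from the primitive cross-paper inputs of
pp. 15–16 instead of «(2.26) per term»

statement-level skeleton of published theorems with citation tags; proofs where landed; nothing here is a claim about
the Yang–Mills mass gap

PDF held: `paper:balaban1988-cmp116-rg-ii-cluster` (journal page = PDF page + 0); pp. 15–17 (materialised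
`p0015.txt`–`p0017.txt`, renders `pub-balaban/b2b-balaban-ref1/pages/1988-cmp116-rg-II-cluster/…-p015/p016/p017-x2.png`;
quoted in full in `B13Term214`, `B13CauchyDecay`, `B13Bound226Primitive`, `B13Lemma3TorusTerms`).

CITATION HEADER (verbatim, p. 17 [PDF 17]): *"This ends the estimate of the expression (2.14). Gathering together all the
bounds we get*
`|(2.14)| ≦ exp(−(κ₁ − 1)(LM)⁻⁴|Z∖Z′₀|)[Π_{Y∈𝐃} 2E₀ε₁C₁α₄⁻¹M^q exp C₂κ₁ exp(−(1 − 3δ)κd_k(Y))] exp(−½γ₂(ε₁²/g_k²)|P|) · exp O(1)α₅|Z|.`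
(2.26) *To get a bound for H(Z) we have to perform the resummation of the terms (2.14) over 𝐃, P and Z₀. … To bound H(Z) we
use the estimate (2.26) for terms of these sums"*; p. 16 [PDF 16]: (2.16) *"|R₁(b, b′)| ≦ (O(1)e^{−⅓δ₀M} + O(α₀ + α₁))
exp(−½δ₀|b₋ − b′₋|)"* and, after (2.19), *"We use the first exponential factor in (2.19) to bound the sum, and this yields
a constant O(1)"*; p. 16: *"1/|τ(Y)| = E₀ε₁C₁α₄⁻¹M^q exp C₂κ₁ exp(−(1 − 3δ)κd_k(Y))"* (2.18).  The volume factors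
(the sentences actually printed; v1.1 docfix, referee finding ref-5 L-g36 (b) = L-g33 (b)): p. 16 [PDF 16] *"the
determinants in the next factor are equal for the new operators, hence this factor can be estimated by*
`exp((O(1)e^{−⅓δ₀M} + O(α₀ + α₁))|Z₀|)`*"* (2.17); p. 17 [PDF 17], below (2.24): *"The factor with the determinants can
be estimated by exp O(1)α₅|Z₀|."*; (2.25) p. 17: `∫dμ₀(X)|_Z exp ½O(α₅)‖ZX‖² = Π_{b∈Z}(1 − O(α₅))^{−1/2} ≦ exp(O(α₅)|Z|)`;
p. 20 [PDF 20] ll. 22–25: *"This exponential is of the same type as the last exponential in (2.37), which can be written as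
exp O(1)(LM)⁴α₅(LM)⁻⁴|Z|. Let us recall the definition of the constant α₅: α₅ = O(1)e^{−⅓δ₀M} + O(α₀ + α₁) + O(1)α₄ + γ₂."*
(v1 of this header rendered these as one sentence «the volume factors above can be bounded by exp O(1)(α₀ + α₁)|Z|, so
they are of the same type as the last factor in (2.26)», which is a PARAPHRASE, not print; the Lean statements are
unchanged.)  The carrier: [I] = CMP 109 p. 251 *"T_η = {x ∈ ηℤ^d : −L_μ ≤ x_μ < L_μ, μ = 1, …, d}"* with periodic
boundary conditions (a torus; `B13Lemma3Torus`).

WHAT IS REPRODUCED (unit `lit-balaban-r10` gen 14, B13 fold owner; SKELETON rows `B13.Eq2.26`, `B13.Eq2.16`,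
`B13.Eq2.18`, `B13.Lem3` of `HOME/lit-balaban-r10/ROWS-B13.md`, HOME = `run/shared/lean/pub/lit-balaban/`; kind
«model-instance joiner»; the optional item of `HOME/lit-balaban-r10/B13-CLOSURE.md` §5 in its torus form).
* §1 THE TORUS GEOMETRY IS AN INSTANCE of `B13Bound226Located`: bonds located on a torus `B5TorusCover.UT N`
  (periods `N : Fin ν → ℕ`) with the ℓ¹ torus distance `B9Thm37GlueTorus.tdist1` — `weightHyp_tdist1` (zero diagonal,
  non-negative, triangle), `tdist1_symm`, and the UNIFORM LATTICE CONSTANT `kc_tdist1` (non-negativity = `B13Bound226Located.kc_l1_nonneg`, the same function): `Σ_{y ∈ T} e^{−b·d₁(x,y)} ≤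
  (1 + 2/b)^ν` for every finite set `T` of torus sites, uniformly in the periods — from
  `B9Thm37GlueTorus.torusSum_tdist1_le` (`≤ c₀(1,b)^ν`) and `c0_one_le` (`c₀(1,b) = Σ_{z∈ℤ} e^{−b|z|} =
  (1+e^{−b})/(1−e^{−b}) ≤ 1 + 2/b`): the torus lattice constant is bounded by the ℤ^ν one of the files of record, so
  every numerical hypothesis below is LITERALLY that of the window joiner.
* §2 **`h226_torus_of_primitives`**: for ONE term `t = (𝐃, P)` of the activity `H(Z)` on the torus model, realized as
  the generic term (2.14) `B13Term214.term214 r lZ lD (core214 A Γ (F214 |P| χY₀ χcP Dfam V)) 0 0` with σ-parameters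
  `lZ` = an enumeration of the blocks of `Z∖Z′₀` (`Z′₀ = tclosure L N′ (Z0 M t)`) and τ-parameters `lD` = an enumeration of
  `𝐃`, the τ-radii being the printed `|τ(Y)| = (invTau c (d_k Y))⁻¹` of (2.18) (`0 < invTau ≤ ½`, `d_k` = the torus tree
  length of `tsys d (L·N′)`), bonds of `Z₀` (`Λ`) and of `Z` (`Λ ⊕ C₀`) located on a torus `UT Nf` (e.g. the unit torus
  of the model) with `≤ m` per site, and with EVERY OTHER HYPOTHESIS THE PRIMITIVE DATA of the capstone (separate
  analyticity in (σ, τ); `A(σ)` symmetric with `Re A(σ) ≻ 0`; the `Γ`-operator linear with kernel `G(σ)`; the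
  (2.22)/(2.20) shapes; uniform localisation of `G(σ)`, `Γ₀`, `A(σ)⁻¹`, `C` and the (2.16)-type difference bounds in the
  TORUS distance; the smallness `K′θ′ < 1`, `α₅c ≤ ½`, `α₅(1+2cg) ≤ ½`), the conclusion is (2.26) IN THE EXACT SPELLING of
  the hypothesis `h226` of `B13Lemma3TorusTerms.hrep_of_termwise` / `bound238_torus_of_226` /
  `deliverables_torus_termwise_of_226`: `‖(2.14)‖ ≤ weight L M c Z a t · exp(a₅·|Z|)`, GIVEN the two constant-matching
  facts of p. 17: the `|P|`-rate of the weight is at most the printed `γ₂(ε₁²/g_k²)` (`hPa : a ≤ γ₂·r_P²`), and the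
  volume exponents of (2.24)–(2.25) plus `w` are at most `a₅·|Z|` (`hvol`).
HONEST SCOPE.  A pure joiner (the torus instance of a landed abstract theorem + the p. 17 constant matching; no
`sorry`, no definition, no new named fact — D-0026).  With it, the torus-model §2 chain `deliverables_torus_termwise_of_226`
runs, upstream of the resummation and term by term, from exactly the by-assertion inputs listed in
`B13Bound226Primitive`/`B13Bound226Located` (the localisation and difference bounds of the PRIMITIVE operators
`C^{(k)}(Z₀,σ)`, its inverse, `Γ_k(Z₀,σ)` — cross-paper [13]/[15], loci L16a/L17a of the cell transcript —, the letters
`c`, `g`, the (2.20)/(2.22) shapes, separate analyticity) plus the (2.14)-representation of `H(Z)`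
(`B13Representation214`), the volume bookkeeping `hvol`, and the chain's own downstream inputs (the log Z^{(k)} half,
(I.1.7), analyticity in (U, J), gauge invariance).  The torus model's readings (over-counted term set, endpoint reading of
Z₀ — HOME GAPS G-B13-P12-01) are those of `B13Lemma3TorusTerms`; the site torus `UT Nf` of the bond locations is a
parameter (its periods are not tied to `L`, `M`, `N′` by this theorem).
-/

namespace Literature.MathematicalPhysics.QuantumFieldTheory.Balaban1983to89.B13Lemma3TorusPrimitive

open Metric Set Matrix
open Literature.MathematicalPhysics.QuantumFieldTheory.Balaban1983to89
open Literature.MathematicalPhysics.QuantumFieldTheory.Balaban1983to89.TreeLengthTorus (TPt TDom tsys)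
open Literature.MathematicalPhysics.QuantumFieldTheory.Balaban1983to89.TreeLengthTorusTransfer (tclosure)
open Literature.MathematicalPhysics.QuantumFieldTheory.Balaban1983to89.B13Lemma3TorusData (TBond)
open Literature.MathematicalPhysics.QuantumFieldTheory.Balaban1983to89.B13Lemma3TorusTerms (weight Z0)
open Literature.MathematicalPhysics.QuantumFieldTheory.Balaban1983to89.B13Term214 (term214 SepHolOn core214 F214)
open Literature.MathematicalPhysics.QuantumFieldTheory.Balaban1983to89.B13Bound143 (invTau)
open Literature.MathematicalPhysics.QuantumFieldTheory.Balaban1983to89.B13CauchyDecay (two_mul_invTau_eq)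
open Literature.MathematicalPhysics.QuantumFieldTheory.Balaban1983to89.B13PerturbativeStep (WeightHyp)
open Literature.MathematicalPhysics.QuantumFieldTheory.Balaban1983to89.B5TorusCover (UT)
open Literature.MathematicalPhysics.QuantumFieldTheory.Balaban1983to89.B9Thm37GlueTorus
  (tdist1 tdist1_self tdist1_comm tdist1_triangle tdist1_nonneg torusSum_tdist1_le)
open Literature.MathematicalPhysics.QuantumFieldTheory.Balaban1983to89.B13Bound226Located
  (norm_term214_le_226_of_primitives kc_l1_nonneg)

noncomputable section

/-! ## §1. The torus geometry is an instance: `ρ = d₁` on `UT N`, lattice constant `(1 + 2/b)^ν` -/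

section TorusInstance

variable {ν : ℕ} {N : Fin ν → ℕ} [∀ i, NeZero (N i)]

/-- The ℓ¹ torus distance is an admissible weight at rate 0 (zero diagonal, non-negative, triangle inequality).
[cite: Balaban1988RG2Cluster, (2.16) p.16 (the weight e^{−δ₀|b₋−b′₋|}, periodic carrier [I] p.251)] -/
theorem weightHyp_tdist1 : WeightHyp 0 (tdist1 N) where
  κ_nonneg := le_rfl
  zero := tdist1_self
  nonneg := tdist1_nonneg
  tri := tdist1_triangle

/-- The ℓ¹ torus distance is symmetric. [folklore] [cite: Balaban1988RG2Cluster, (2.16) p.16] -/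
theorem tdist1_symm : ∀ x y : UT N, tdist1 N x y = tdist1 N y x := tdist1_comm

/-- `c₀(1, b) = Σ_{z ∈ ℤ} e^{−b|z|} = (1 + e^{−b})/(1 − e^{−b}) ≤ 1 + 2/b` for `b > 0` (two geometric series and
`e^{b} ≥ 1 + b`) — the one-dimensional torus lattice constant is at most the one-dimensional ℤ one. [folklore]
[cite: Balaban1988RG2Cluster, p.16 after (2.19) ("this yields a constant O(1)")] -/
theorem c0_one_le {b : ℝ} (hb : 0 < b) : B6.c0 1 b ≤ 1 + 2 / b := by
  unfold B6.c0
  simp only [mul_one]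
  have hr : Real.exp (-b) < 1 := by rw [Real.exp_lt_one_iff]; linarith
  have hr0 : 0 ≤ Real.exp (-b) := (Real.exp_pos _).le
  have hnat_eq : (fun n : ℕ => Real.exp (-(b * |((n : ℤ) : ℝ)|))) = fun n : ℕ => Real.exp (-b) ^ n := by
    funext n
    rw [← Real.exp_nat_mul]; congr 1
    rw [Int.cast_natCast, abs_of_nonneg (Nat.cast_nonneg n)]; ring
  have hneg_eq : (fun n : ℕ => Real.exp (-(b * |((-((n : ℤ) + 1) : ℤ) : ℝ)|)))
      = fun n : ℕ => Real.exp (-b) * Real.exp (-b) ^ n := by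
    funext n
    rw [← pow_succ', ← Real.exp_nat_mul]; congr 1
    have hc : ((-((n : ℤ) + 1) : ℤ) : ℝ) = -((n : ℝ) + 1) := by push_cast; ring
    rw [hc, abs_neg, abs_of_nonneg (by positivity)]; push_cast; ring
  have hnat : Summable fun n : ℕ => Real.exp (-(b * |((n : ℤ) : ℝ)|)) := by
    rw [hnat_eq]; exact summable_geometric_of_lt_one hr0 hr
  have hneg : Summable fun n : ℕ => Real.exp (-(b * |((-((n : ℤ) + 1) : ℤ) : ℝ)|)) := by
    rw [hneg_eq]; exact (summable_geometric_of_lt_one hr0 hr).mul_left _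
  have h1 : ∑' n : ℕ, Real.exp (-(b * |((n : ℤ) : ℝ)|)) = (1 - Real.exp (-b))⁻¹ := by
    rw [hnat_eq]; exact tsum_geometric_of_lt_one hr0 hr
  have h2 : ∑' n : ℕ, Real.exp (-(b * |((-((n : ℤ) + 1) : ℤ) : ℝ)|))
      = Real.exp (-b) * (1 - Real.exp (-b))⁻¹ := by
    rw [hneg_eq, tsum_mul_left, tsum_geometric_of_lt_one hr0 hr]
  rw [tsum_of_nat_of_neg_add_one (f := fun z : ℤ => Real.exp (-(b * |(z : ℝ)|))) hnat hneg, h1, h2]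
  have htail : Real.exp (-b) / (1 - Real.exp (-b)) ≤ 1 / b := by
    have h : Real.exp (-b) * (b + 1) ≤ 1 := by
      calc Real.exp (-b) * (b + 1) ≤ Real.exp (-b) * Real.exp b :=
            mul_le_mul_of_nonneg_left (by linarith [Real.add_one_le_exp b]) (Real.exp_pos _).le
        _ = 1 := by rw [← Real.exp_add]; simp
    rw [div_le_div_iff₀ (by linarith) hb]
    nlinarith [h, Real.exp_pos (-b)]
  have hne : 1 - Real.exp (-b) ≠ 0 := by linarith
  have hval : (1 - Real.exp (-b))⁻¹ + Real.exp (-b) * (1 - Real.exp (-b))⁻¹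
      = 1 + 2 * (Real.exp (-b) / (1 - Real.exp (-b))) := by
    field_simp
    ring
  calc (1 - Real.exp (-b))⁻¹ + Real.exp (-b) * (1 - Real.exp (-b))⁻¹
      = 1 + 2 * (Real.exp (-b) / (1 - Real.exp (-b))) := hval
    _ ≤ 1 + 2 * (1 / b) := by linarith [htail]
    _ = 1 + 2 / b := by ring

/-- **The uniform lattice constant of the torus in the ℓ¹ distance**: `Σ_{y ∈ T} e^{−b·d₁(x,y)} ≤ (1 + 2/b)^ν` for every
finite set `T` of sites of the torus `UT N`, every `x`, every `b > 0`, uniformly in the periods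
(`B9Thm37GlueTorus.torusSum_tdist1_le` + `c0_one_le`) — the printed *"this yields a constant O(1)"* on the periodic
carrier, with the ℤ^ν constant of `B2Lemma25Proof.sum_exp_neg_l1dist_le`. [cite: Balaban1988RG2Cluster, p.16 after (2.19)] -/
theorem kc_tdist1 : ∀ b : ℝ, 0 < b → ∀ (T : Finset (UT N)) (x : UT N),
    ∑ y ∈ T, Real.exp (-(b * tdist1 N x y)) ≤ (fun b : ℝ => (1 + 2 / b) ^ ν) b := by
  intro b hb T x
  have hb1 : 0 < b * 1 := by rwa [mul_one]
  have hc0 : 0 ≤ B6.c0 1 b := zero_le_one.trans (B6Lemma21Arith.one_le_c0 hb1)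
  calc ∑ y ∈ T, Real.exp (-(b * tdist1 N x y)) ≤ ∑ y, Real.exp (-(b * tdist1 N x y)) :=
        Finset.sum_le_univ_sum_of_nonneg fun y => (Real.exp_pos _).le
    _ = ∑ y, Real.exp (-(b * 1 * tdist1 N x y)) := by simp only [mul_one]
    _ ≤ B6.c0 1 b ^ ν := torusSum_tdist1_le x hb1
    _ ≤ (1 + 2 / b) ^ ν := pow_le_pow_left₀ hc0 (c0_one_le hb) ν

end TorusInstance

/-! ## §2. (2.26) for one term of the torus model, from the primitive objects -/

section Joiner

variable {d L N' : ℕ} [NeZero L] [NeZero N'] {M : ℕ}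
variable {ν : ℕ} {Nf : Fin ν → ℕ} [∀ i, NeZero (Nf i)]
variable {Λ : Type} [Fintype Λ] [DecidableEq Λ] {C₀ : Type} [Fintype C₀] [DecidableEq C₀]

open Classical in
/-- **(2.26) FOR ONE TERM of the torus model, from the PRIMITIVE objects** — p. 17 *"Gathering together all the bounds
we get (2.26)"* in the spelling consumed by the torus resummation (`B13Lemma3TorusTerms.hrep_of_termwise`, hypothesis
`h226`): if the term `t = (𝐃, P)` of `H(Z)` is the generic term (2.14) `term214 r lZ lD (core214 A Γ (F214 |P| χY₀ χcP
Dfam V)) 0 0` (σ-parameters `lZ` = the blocks of `Z∖Z′₀`, τ-parameters `lD` = `𝐃`, τ-radii `|τ(Y)| = (invTau c (d_k Y))⁻¹`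
of (2.18) with `0 < invTau ≤ ½`), and the primitive data of `B13Bound226Located.norm_term214_le_226_of_primitives` hold
on bonds located on the torus `UT Nf` with the ℓ¹ torus distance (separate analyticity; `A(σ)` symmetric, `Re A(σ) ≻ 0`;
linear `Γ(σ) = G(σ)·`; the (2.22)/(2.20) shapes with constants `γ₂, r_P, a₂₀, w`; `≤ m` bonds per site; uniform
localisation of `G(σ)`, `Γ₀`, `A(σ)⁻¹`, `C` and the (2.16)-type difference bounds at rates `κ > κ′ > κ″ > 0`; the
smallness conditions), then `‖(2.14)‖ ≤ weight L M c Z a t · exp(a₅ · |Z|)` as soon as `a ≤ γ₂ r_P²` (the weight's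
`|P|`-rate is at most the printed `½γ₂(ε₁²/g_k²)`) and the volume exponents of (2.24)–(2.25) plus `w` are at most
`a₅ · |Z|` (print: (2.17) p. 16; p. 17 *"The factor with the determinants can be estimated by exp O(1)α₅|Z₀|"*; (2.25)
*"≦ exp(O(α₅)|Z|)"*). [cite: Balaban1988RG2Cluster, (2.14)–(2.15) p.15, (2.16)–(2.22) p.16, (2.23)–(2.26) p.17] -/
theorem h226_torus_of_primitives (c : B13.Consts) (hκ₁ : 1 ≤ c.κ₁) (hα₆ : c.α₆ ≠ 0)
    (Z : TDom d N') (t : Finset (TDom d (L * N')) × Finset (TBond d M (L * N')))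
    (hpos : ∀ Y : TDom d (L * N'), 0 < invTau c ((tsys d (L * N')).dj Y))
    (hhalf : ∀ Y : TDom d (L * N'), invTau c ((tsys d (L * N')).dj Y) ≤ 1 / 2)
    {Uσ Uτ : Set ℂ} (hUσ : IsOpen Uσ) (hUτ : IsOpen Uτ) (hUexp : closedBall (0 : ℂ) (Real.exp c.κ₁) ⊆ Uσ)
    (hUtau : ∀ Y : TDom d (L * N'), closedBall (0 : ℂ) ((invTau c ((tsys d (L * N')).dj Y))⁻¹) ⊆ Uτ)
    {r : ℝ} (hr : 0 < r) (hr' : r ≤ Real.exp c.κ₁ - 1)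
    (hsubτ : ∀ s ∈ Set.uIcc (0 : ℝ) 1, closedBall (s : ℂ) r ⊆ Uτ)
    -- the parameter lists of the term: σ over the blocks of Z∖Z′₀, τ over 𝐃
    (lZ : List (TPt d N')) (hlZ : lZ.Nodup ∧ lZ.toFinset = Z.1 \ tclosure L N' (Z0 M t))
    (lD : List (TDom d (L * N'))) (hlD : lD.Nodup ∧ lD.toFinset = t.1)
    -- the (2.14)-data of the term
    (A : (TPt d N' → ℂ) → Matrix Λ Λ ℂ) (Γ : (TPt d N' → ℂ) → (Λ ⊕ C₀ → ℝ) → (Λ → ℂ))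
    (χY₀ χcP : (Λ → ℝ) → ℝ) (hχ0 : ∀ B, 0 ≤ χY₀ B) (hχc0 : ∀ B, 0 ≤ χcP B) (Dfam : Finset (TDom d (L * N')))
    (V : TDom d (L * N') → (Λ → ℝ) → ℂ)
    (hΨσ : ∀ τ : TDom d (L * N') → ℂ, (∀ j, τ j ∈ Uτ) →
      SepHolOn Uσ (fun σ => core214 A Γ (F214 t.2.card χY₀ χcP Dfam V) σ τ))
    (hΨτ : ∀ σ : TPt d N' → ℂ, (∀ j, σ j ∈ Uσ) →
      SepHolOn Uτ (fun τ => core214 A Γ (F214 t.2.card χY₀ χcP Dfam V) σ τ))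
    {C : Matrix Λ Λ ℝ} (hC : C.PosDef) (Γ₀ : Matrix Λ (Λ ⊕ C₀) ℝ)
    (hAs : ∀ σ : TPt d N' → ℂ, (∀ j, ‖σ j‖ ≤ Real.exp c.κ₁) → (A σ).IsSymm)
    (hA : ∀ σ : TPt d N' → ℂ, (∀ j, ‖σ j‖ ≤ Real.exp c.κ₁) → ((A σ).map Complex.re).PosDef)
    -- the Γ-operator is linear with kernel G(σ)
    (G : (TPt d N' → ℂ) → Matrix Λ (Λ ⊕ C₀) ℂ)
    (hlin : ∀ σ : TPt d N' → ℂ, (∀ j, ‖σ j‖ ≤ Real.exp c.κ₁) →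
      ∀ X : Λ ⊕ C₀ → ℝ, Γ σ X = G σ *ᵥ fun j => (X j : ℂ))
    -- the (2.22) and (2.20) shapes
    {γ₂ rP a₂₀ w : ℝ} (qP : (Λ → ℝ) → ℝ)
    (h222 : ∀ B, χY₀ B * χcP B ≤ Real.exp (-(γ₂ / 2 * rP ^ 2 * (t.2.card : ℕ)) + γ₂ / 2 * qP B)) (hγ₂ : 0 ≤ γ₂)
    (hqP : ∀ B, qP B ≤ B ⬝ᵥ B)
    (h220R : ∀ B, ∑ Y ∈ Dfam, (invTau c ((tsys d (L * N')).dj Y))⁻¹ * ‖V Y B‖ ≤ a₂₀ / 2 * (B ⬝ᵥ B) + w)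
    (ha0 : 0 ≤ a₂₀)
    -- bonds located on the torus `UT Nf`
    (locΛ : Λ → UT Nf) (locN : Λ ⊕ C₀ → UT Nf) {m : ℕ}
    (hfibΛ : ∀ x : UT Nf, (Finset.univ.filter fun i => locΛ i = x).card ≤ m)
    (hfibN : ∀ x : UT Nf, (Finset.univ.filter fun j => locN j = x).card ≤ m)
    -- rates and constants
    {kap kap' kap'' θ θE θΓ θC KG KΓ KCs K₀ : ℝ} (hkap'' : 0 < kap'') (h1 : kap'' < kap') (h2 : kap' < kap)
    (hθE : 0 ≤ θE) (hθΓ : 0 ≤ θΓ) (hθC : 0 ≤ θC) (hKG : 0 ≤ KG) (hKΓ : 0 ≤ KΓ) (hKCs : 0 ≤ KCs) (hK₀ : 0 ≤ K₀)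
    (hθEle : θE ≤ θ) (hθΓle : θΓ ≤ θ)
    (hθR1le : (m * (1 + 2 / (kap - kap')) ^ ν) * (m * (1 + 2 / (kap' - kap'')) ^ ν)
      * (θΓ * KCs * KG + KΓ * θC * KG + KΓ * K₀ * θΓ) ≤ θ)
    -- uniform localisation of the primitive kernels in the torus distance (L17a)
    (hG : ∀ σ : TPt d N' → ℂ, (∀ j, ‖σ j‖ ≤ Real.exp c.κ₁) →
      ∀ b j, ‖G σ b j‖ ≤ KG * Real.exp (-(kap * tdist1 Nf (locΛ b) (locN j))))
    (hΓ₀ : ∀ b j, ‖Γ₀ b j‖ ≤ KΓ * Real.exp (-(kap * tdist1 Nf (locΛ b) (locN j))))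
    (hCs : ∀ σ : TPt d N' → ℂ, (∀ j, ‖σ j‖ ≤ Real.exp c.κ₁) →
      ∀ b b', ‖(A σ)⁻¹ b b'‖ ≤ KCs * Real.exp (-(kap * tdist1 Nf (locΛ b) (locΛ b'))))
    (hC216 : ∀ b b', ‖C b b'‖ ≤ K₀ * Real.exp (-(kap * tdist1 Nf (locΛ b) (locΛ b'))))
    -- the (2.16)-type differences of the primitive kernels in the torus distance (L16a)
    (hdΓ : ∀ σ : TPt d N' → ℂ, (∀ j, ‖σ j‖ ≤ Real.exp c.κ₁) →
      ∀ b j, ‖(G σ - Γ₀.map (algebraMap ℝ ℂ)) b j‖ ≤ θΓ * Real.exp (-(kap * tdist1 Nf (locΛ b) (locN j))))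
    (hdC : ∀ σ : TPt d N' → ℂ, (∀ j, ‖σ j‖ ≤ Real.exp c.κ₁) →
      ∀ b b', ‖((A σ)⁻¹ - C.map (algebraMap ℝ ℂ)) b b'‖
        ≤ θC * Real.exp (-(kap * tdist1 Nf (locΛ b) (locΛ b'))))
    (hdE : ∀ σ : TPt d N' → ℂ, (∀ j, ‖σ j‖ ≤ Real.exp c.κ₁) →
      ∀ b b', ‖(A σ - C⁻¹.map (algebraMap ℝ ℂ)) b b'‖ ≤ θE * Real.exp (-(kap * tdist1 Nf (locΛ b) (locΛ b'))))
    (hsmallKθ : K₀ * (m * (1 + 2 / kap) ^ ν) * (θ * (m * (1 + 2 / kap'') ^ ν)) < 1)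
    -- the (2.24)–(2.25) smallness
    {cE g : ℝ} (hc0 : 0 ≤ cE) (hc : ∀ k, hC.1.eigenvalues k ≤ cE)
    (hαc : (2 * (θ * (m * (1 + 2 / kap'') ^ ν)) + (γ₂ + a₂₀)) * cE ≤ 1 / 2) (hg : 0 ≤ g)
    (hΓq : ∀ X : Λ ⊕ C₀ → ℝ, (Γ₀ *ᵥ X) ⬝ᵥ (C *ᵥ (Γ₀ *ᵥ X)) ≤ g * (X ⬝ᵥ X))
    (hsmall : (2 * (θ * (m * (1 + 2 / kap'') ^ ν)) + (γ₂ + a₂₀)) * (1 + 2 * cE * g) ≤ 1 / 2)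
    -- constant matching, p. 17: the |P|-rate of the weight and «exp O(1)α₅|Z|»
    {a a₅ : ℝ} (hPa : a ≤ γ₂ * rP ^ 2)
    (hvol : 2 * (K₀ * (m * (1 + 2 / kap) ^ ν) * (θ * (m * (1 + 2 / kap'') ^ ν))
              * (1 + (1 - K₀ * (m * (1 + 2 / kap) ^ ν) * (θ * (m * (1 + 2 / kap'') ^ ν)))⁻¹) / 2)
          * (Fintype.card Λ : ℝ)
        + w + (2 * (θ * (m * (1 + 2 / kap'') ^ ν)) + (γ₂ + a₂₀)) * cE * (Fintype.card Λ : ℝ)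
        + (2 * (θ * (m * (1 + 2 / kap'') ^ ν)) + (γ₂ + a₂₀)) * (1 + 2 * cE * g) * (Fintype.card (Λ ⊕ C₀) : ℝ)
        ≤ a₅ * ((Z.1).card : ℝ)) :
    ‖term214 r lZ lD (core214 A Γ (F214 t.2.card χY₀ χcP Dfam V)) 0 0‖ ≤
      weight L M c Z a t * Real.exp (a₅ * ((Z.1).card : ℝ)) := by
  obtain ⟨hlZ1, hlZ2⟩ := hlZ
  obtain ⟨hlD1, hlD2⟩ := hlD
  -- the τ-radii `|τ(Y)| = (invTau …)⁻¹ ≥ 2`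
  have hR2 : ∀ Y : TDom d (L * N'), (2 : ℝ) ≤ (invTau c ((tsys d (L * N')).dj Y))⁻¹ := fun Y => by
    rw [le_inv_comm₀ (by norm_num) (hpos Y)]; simpa [one_div] using hhalf Y
  have h := norm_term214_le_226_of_primitives (ι := TPt d N') (κ := TDom d (L * N'))
    (weightHyp_tdist1 (N := Nf)) tdist1_symm kc_tdist1 kc_l1_nonneg hκ₁
    (fun Y : TDom d (L * N') => (invTau c ((tsys d (L * N')).dj Y))⁻¹) hR2 hUσ hUτ hUexp hUtau hr hr' hsubτ A Γ
    t.2.card χY₀ χcP hχ0 hχc0 Dfam V hΨσ hΨτ hC Γ₀ hAs hA G hlin qP h222 hγ₂ hqP h220R ha0 locΛ locN hfibΛ hfibN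
    hkap'' h1 h2 hθE hθΓ hθC hKG hKΓ hKCs hK₀ hθEle hθΓle hθR1le hG hΓ₀ hCs hC216 hdΓ hdC hdE hsmallKθ hc0 hc hαc
    hg hΓq hsmall hlZ1 hlD1 (σ₀ := 0) (fun _ => by simp) (τ₀ := 0) (fun _ => by simp)
  -- `|lZ| = #blocks(Z∖Z′₀)` and `2/|τ(Y)| = α₆ε₂e^{−(1−3δ)κd_k(Y)}`
  have hlen : ((lZ.length : ℕ) : ℝ) = ((Z.1 \ tclosure L N' (Z0 M t)).card : ℝ) := by
    rw [← List.toFinset_card_of_nodup hlZ1, hlZ2]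
  have hprod : (∏ Y ∈ lD.toFinset, 2 * ((invTau c ((tsys d (L * N')).dj Y))⁻¹)⁻¹) =
      ∏ Y ∈ t.1, c.α₆ * c.eps2 * Real.exp (-((1 - 3 * c.δ) * c.κ * (tsys d (L * N')).dj Y)) := by
    rw [hlD2]
    refine Finset.prod_congr rfl fun Y _ => ?_
    rw [inv_inv, two_mul_invTau_eq c hα₆]
    ring_nf
  -- the volume factors and the |P|-rate (p. 17)
  have hP0 : (0 : ℝ) ≤ (t.2.card : ℕ) := Nat.cast_nonneg _
  have hPrate : -(γ₂ / 2 * rP ^ 2 * (t.2.card : ℕ)) ≤ -(a / 2 * (t.2.card : ℝ)) := by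
    have := mul_le_mul_of_nonneg_right hPa hP0
    linarith
  have hGauss :
      Real.exp (2 * (K₀ * (m * (1 + 2 / kap) ^ ν) * (θ * (m * (1 + 2 / kap'') ^ ν))
              * (1 + (1 - K₀ * (m * (1 + 2 / kap) ^ ν) * (θ * (m * (1 + 2 / kap'') ^ ν)))⁻¹) / 2)
            * (Fintype.card Λ : ℝ))
          * Real.exp (-(γ₂ / 2 * rP ^ 2 * ((t.2.card : ℕ) : ℝ)) + w)
          * (Real.exp ((2 * (θ * (m * (1 + 2 / kap'') ^ ν)) + (γ₂ + a₂₀)) * cE * (Fintype.card Λ : ℝ))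
            * Real.exp ((2 * (θ * (m * (1 + 2 / kap'') ^ ν)) + (γ₂ + a₂₀)) * (1 + 2 * cE * g)
              * (Fintype.card (Λ ⊕ C₀) : ℝ))) ≤
        Real.exp (-(a / 2 * (t.2.card : ℝ))) * Real.exp (a₅ * ((Z.1).card : ℝ)) := by
    rw [← Real.exp_add, ← Real.exp_add, ← Real.exp_add, ← Real.exp_add, Real.exp_le_exp]
    linarith
  have hF12 : 0 ≤ Real.exp (-(c.κ₁ - 1) * lZ.length) *
      ∏ Y ∈ lD.toFinset, 2 * ((invTau c ((tsys d (L * N')).dj Y))⁻¹)⁻¹ :=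
    mul_nonneg (Real.exp_nonneg _)
      (Finset.prod_nonneg fun Y _ => mul_nonneg zero_le_two (inv_nonneg.2 (inv_nonneg.2 (hpos Y).le)))
  refine h.trans ((mul_le_mul_of_nonneg_left hGauss hF12).trans (le_of_eq ?_))
  rw [hprod, weight, ← hlen]
  ring_nf

end Joiner

end

end Literature.MathematicalPhysics.QuantumFieldTheory.Balaban1983to89.B13Lemma3TorusPrimitive
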